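import Summits.BirchSwinnertonDyer.BirchSwinnertonDyer.Theorems.PrintCFramBottomClassIndexLawFiveLeClassGroupChiCensus
import Summits.BirchSwinnertonDyer.BirchSwinnertonDyer.Theorems.PrintCFramBottomClassIndexLawFiveLeSelmerCountLevelZeroLine
import Summits.BirchSwinnertonDyer.BirchSwinnertonDyer.Theorems.PrintCFramBottomClassIndexLawFiveLeLevelDictionaryBetaConsumer
import Summits.BirchSwinnertonDyer.BirchSwinnertonDyer.Theorems.PrintCFramBottomClassIndexLawFiveLeLevelDictionaryStrictSelmerSha
import HarnessLib

/-!
# Route `PrintCFram`, crux C2 `BottomClassIndexLawFiveLe` (stmt-BirchSwinnertonDyer-20372), line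
# `eisenstein-resource-bdp-line` (registry v24, arithmetic pair `stub_bsdp_of_level` / `stub_bsdp_of_sha_levelZero`): **THE LEVEL-0 CENSUS,
# MODEL-FREE — `Ш(W)[p] ≠ 0 ⟺ (class factor non-unit ∧ θ_e-IRREGULAR)` for a rank-one CM-ramified member with a LEVEL-0 generator, in
# the Kriz–Li datum currency `(f, ψ, ω, hss)`** (cell `bsd-print-cfram`, width seat `bsd-line-cfram-p1-w2` g12; helper `--supports` 20372;
# 0 defs, 0 facts, 0 sorry; CONDITIONAL on the named facts it lists: Mazur–Wiles Thm. 2 (Ribet direction) on the `⟸` side for the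
# ψ-ALIGNED model, Cassels–Tate + GZK on the `⟹` side)

HONEST FRAMING. Nothing about BSD is proved here and no stub is closed; the arithmetic pair stays OPEN (promote). This file ASSEMBLES the
level-0 census of the B1-sha⁰ members (`stub_bsdp_of_sha_levelZero`) for BOTH `p`-isogenous models of a class member at once, in the
binder currency of the registry (`W`, CM, `p ≥ 5` CM-ramified, the Kriz–Li character datum `(f, ψ, ω)` with the trace form `hss`, a
generator `P` of `W(ℚ)` modulo torsion of LEVEL `0`):

* §1 `exists_sha_ne_zero_of_level_zero_of_unramified_sub_class` — LEVEL 0 ∧ a non-zero everywhere-unramified class of the stable line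
  ⟹ `Ш(W)[p] ≠ 0` (strictness at `p` is automatic: `SelmerCount.exists_principal_on_of_principal_on_subgroup` + `Φ^{I_𝔓} = 0`; then the
  level-0 injection p686891). No named fact.
* §2 **`exists_sha_ne_zero_of_level_zero_of_classFactor_of_evenIrregular`** (`⟸`, mod MW): LEVEL 0 ∧ CLASS FACTOR NON-UNIT
  (`0 < ‖B_{1,ψ⁻¹}‖ ≤ p⁻¹`) ∧ θ_e-IRREGULAR at ONE Galois realisation of `ω ψ⁻¹` (`p ∤` degree) ⟹ `Ш(W)[p] ≠ 0`. PROOF by the model: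
  ψ-ALIGNED (the stable line is odd and realises `ψ`): Mazur–Wiles gives the unramified class of the line (w5 g3
  `LevelDictionaryBeta.exists_unramified_class_of_odd_avatar_of_norm_bernoulli_lt_one`), §1 — the θ_e-hypothesis is not used;
  ψ-TRANSVERSE (the stable line is even, character `θ_e`, the twin `W_ψ/Φ`): realisation independence moves the irregularity to the
  field `ℚ̄^{ker θ_e}` and `SelmerCount.exists_sha_ne_zero_of_level_zero_of_lineClassGroupChiCard_ne_one` (this seat, file D) concludes —
  Mazur–Wiles is not used.
* §3 **`classFactor_and_evenIrregular_of_level_zero_of_sha_ne_zero`** (`⟹`, mod CT+GZK): LEVEL 0 ∧ `Ш(W)[p] ≠ 0` ⟹ CLASS FACTOR NON-UNIT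
  (w6 g3 (α′) `sha_torsion_eq_zero_of_unit_classFactor`, descent only) ∧ θ_e-IRREGULAR at EVERY Galois realisation (this seat, file C).
* §4 **`sha_ne_zero_iff_of_level_zero`** — the IFF.

NET (dossier): B1-sha⁰'s members are EXACTLY the level-0 members off the Kriz–Li locus whose even character `θ_e = ω ψ⁻¹` is class-group
irregular (at one, equivalently every, Galois realisation of degree prime to `p`; e.g. the real cyclic field `ℚ̄^{ker θ_e}` of degree
dividing `p − 1`) — for BOTH models; on the ψ-aligned model «off-locus ∧ level 0» already forces this (w5 g3 (β) + w4 g10). THEOREMS ONLY;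
no definition, no named fact, no `sorry`. BSD is not proved by any of this; no summit statement is proved by this seat.
References: [MazurWiles1984] Thm. 2; [Washington1997] §10.2; [SilvermanAEC2009] X.§4; [Cassels1962ArithmeticIV]; [KrizLi2019] (29).
-/

set_option autoImplicit false
-- `…BirchSwinnertonDyer.BirchSwinnertonDyer.Theorems…` is the problem's mandated namespace (D-0017).
set_option linter.dupNamespace false

noncomputable section

open scoped Classical Pointwise

namespace Summit.BirchSwinnertonDyer.BirchSwinnertonDyer.Theorems.PrintCFram.SelmerCount

open NumberField IsDedekindDomain Field WeierstrassCurve DirichletCharacter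
open Literature.NumberTheory.NumberFields Literature.NumberTheory.EllipticCurves Literature.NumberTheory.GaloisRepresentations
  Literature.NumberTheory.EllipticCurves.Rank1Residual Literature.NumberTheory.EllipticCurves.KrizLi2019
  Literature.NumberTheory.EllipticCurves.GreenbergSelmer
open Summit.BirchSwinnertonDyer.Rank1Residual.X2.ResidualDevissageModules
open Summit.BirchSwinnertonDyer.BirchSwinnertonDyer.Theorems.PrintCFram.ClassGroupChiTower
open Summit.BirchSwinnertonDyer.BirchSwinnertonDyer.Theorems.PrintCFram.LevelDictionaryAlpha

variable {p : ℕ} [hp : Fact p.Prime]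
variable (W : WeierstrassCurve ℚ) [W.IsElliptic] [W.IsGloballyMinimal]

/-! ## §1 LEVEL 0 ∧ an everywhere-unramified non-zero class of the stable line ⟹ `Ш(W)[p] ≠ 0` -/

/-- **LEVEL 0 ∧ a non-zero everywhere-unramified class of the stable line ⟹ `Ш(W/ℚ)[p] ≠ 0`** (no named fact). `W/ℚ` globally minimal
with CM, `p ≥ 5` CM-ramified, `v ∋ p`, `Φ ≤ W[p]` a `Γ_ℚ`-stable line of order `p`, `P` a generator of `W(ℚ)` modulo torsion of LEVEL `0`;
`w : Γ_ℚ → Φ` a continuous crossed homomorphism with non-zero class, principal on EVERY inertia group. Then `∃ c ∈ Ш(W/ℚ), c ≠ 0 ∧ p•c = 0`: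
`w` is STRICT at `p` (principal on `D_v`, since `Φ^{I_𝔓} = 0` — `exists_principal_on_of_principal_on_subgroup`), its class has order `p` in
`R_rel(Φ) ⊓ ker res_{D_v}`, and w2 g11's level-0 injection (p686891) applies. [cite: SilvermanAEC2009, X.§4]
[cite: SerreGaloisCohomology1997, I.§2.6 (b)] -/
theorem exists_sha_ne_zero_of_level_zero_of_unramified_sub_class
    (hCM : W.HasCM) (hram : CMRamified W p) (h5 : 5 ≤ p)
    {v : HeightOneSpectrum (𝓞 ℚ)} (hpv : ((p : ℕ) : 𝓞 ℚ) ∈ v.asIdeal)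
    (Φ : StableSubgroup (absoluteGaloisGroup ℚ) (geomTorsion W (p : ℤ))) (hcard : Nat.card Φ.Sub = p)
    (P : W.toAffine.Point)
    (hgen : ∀ R : W.toAffine.Point, ∃ (k : ℤ) (T : W.toAffine.Point), IsOfFinAddOrder T ∧ R = k • P + T)
    (hlev : ∀ Q : (W.baseChange ℚ_[p]).toAffine.Point, p • Q ≠ W.toPadicPoint p P)
    (w : contOneCocycles (discreteTopRep (absoluteGaloisGroup ℚ) Φ.Sub)) (hw0 : oneCocycleClass _ w ≠ 0)
    (hwI : ∀ (v' : HeightOneSpectrum (𝓞 ℚ)) (𝔓 : Ideal (absIntegers (𝓞 ℚ) ℚ)), 𝔓 ∈ v'.primesAbove →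
      ∃ a : Φ.Sub, ∀ g ∈ 𝔓.inertia (absoluteGaloisGroup ℚ), w.1 g = g • a - a) :
    ∃ c ∈ W.sha, c ≠ 0 ∧ p • c = 0 := by
  have hpr : p.Prime := hp.out
  have hp0 : ((p : ℕ) : ℤ) ≠ 0 := by exact_mod_cast hpr.ne_zero
  have hcont : ∀ s : Φ.Sub, Continuous fun g : absoluteGaloisGroup ℚ ↦ g • s :=
    Φ.continuous_smul_sub (LevelDictionary.continuous_smul_geomTorsion W (p : ℤ))
  set Sp : Set (HeightOneSpectrum (𝓞 ℚ)) := {v' : HeightOneSpectrum (𝓞 ℚ) | ((p : ℕ) : 𝓞 ℚ) ∈ v'.asIdeal} with hSp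
  set c := oneCocycleClass (discreteTopRep (absoluteGaloisGroup ℚ) Φ.Sub) w with hc
  have hunr : c ∈ h1Unramified Φ.Sub Sp := by
    rw [mem_h1Unramified_iff]
    intro v' _ 𝔓 h𝔓
    change c ∈ subgroupResKer Φ.Sub (𝔓.inertia (absoluteGaloisGroup ℚ))
    rw [hc, oneCocycleClass_mem_subgroupResKer_iff]
    obtain ⟨a, ha⟩ := hwI v' 𝔓 h𝔓
    exact ⟨a, fun σ => ha σ σ.2⟩
  have hstr : c ∈ subgroupResKer Φ.Sub (decomp v) := by
    obtain ⟨a, ha⟩ := hwI v (adicCompletionPrime ℚ v) (adicCompletionPrime_mem_primesAbove ℚ v)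
    rw [hc, oneCocycleClass_mem_subgroupResKer_iff]
    have hconj : ∀ d ∈ (adicCompletionPrime ℚ v).decompositionSubgroup (absoluteGaloisGroup ℚ),
        ∀ i ∈ (adicCompletionPrime ℚ v).inertia (absoluteGaloisGroup ℚ),
          d * i * d⁻¹ ∈ (adicCompletionPrime ℚ v).inertia (absoluteGaloisGroup ℚ) := fun d hd i hi => by
      have hd' : d • adicCompletionPrime ℚ v = adicCompletionPrime ℚ v := (Ideal.mem_decompositionSubgroup_iff).mp hd
      have h := (Ideal.conj_mem_inertia_smul_iff (adicCompletionPrime ℚ v) d i).mpr hi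
      rwa [hd'] at h
    refine ⟨a, fun τ => ?_⟩
    have hτ' : (τ : absoluteGaloisGroup ℚ) ∈ (adicCompletionPrime ℚ v).decompositionSubgroup (absoluteGaloisGroup ℚ) := by
      rw [decompositionSubgroup_adicCompletionPrime_eq_range]; exact τ.2
    exact exists_principal_on_of_principal_on_subgroup w ((adicCompletionPrime ℚ v).inertia (absoluteGaloisGroup ℚ))
      ((adicCompletionPrime ℚ v).decompositionSubgroup (absoluteGaloisGroup ℚ)) hconj
      (fun m hm => sub_eq_zero_of_forall_inertia_smul_eq_at_p W Φ hCM h5 hram hcard hpv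
        (adicCompletionPrime_mem_primesAbove ℚ v) m hm) ha τ hτ'
  have hSpfin : Sp.Finite := by
    convert finite_setOf_intCast_mem_asIdeal (K := ℚ) hp0 using 1
    ext v'
    simp only [hSp, Set.mem_setOf_eq, Int.cast_natCast]
  haveI : Finite Φ.Sub := Nat.finite_of_card_ne_zero (by rw [hcard]; exact hpr.ne_zero)
  haveI hfin : Finite ↥(h1Unramified Φ.Sub Sp) := finite_h1Unramified_of_continuous Φ.Sub hcont hSpfin
  haveI : Finite ↥(h1Unramified Φ.Sub Sp ⊓ subgroupResKer Φ.Sub (decomp v)) :=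
    Finite.of_injective _ (AddSubgroup.inclusion_injective inf_le_left)
  have hmem : c ∈ h1Unramified Φ.Sub Sp ⊓ subgroupResKer Φ.Sub (decomp v) := ⟨hunr, hstr⟩
  have hc0 : c ≠ 0 := by rw [hc]; exact hw0
  have hpw : p • w = 0 := by
    refine Subtype.ext (ContinuousMap.ext fun g => ?_)
    change p • w.1 g = 0
    exact HerbrandLineRestriction.prime_nsmul_eq_zero_of_card_prime hcard _
  have hpc : p • c = 0 := by
    rw [hc, ← oneCocycleClassₗ_apply, ← map_nsmul, hpw, map_zero]
  have hle : p ≤ Nat.card ↥(h1Unramified Φ.Sub Sp ⊓ subgroupResKer Φ.Sub (decomp v)) := by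
    set x : ↥(h1Unramified Φ.Sub Sp ⊓ subgroupResKer Φ.Sub (decomp v)) := ⟨c, hmem⟩ with hx
    have hx0 : x ≠ 0 := fun h => hc0 (congrArg Subtype.val h)
    have hpx : p • x = 0 := Subtype.ext hpc
    have hord : addOrderOf x = p := by
      rcases (Nat.dvd_prime hpr).mp (addOrderOf_dvd_of_nsmul_eq_zero hpx) with h1 | hpeq
      · exact absurd (AddMonoid.addOrderOf_eq_one_iff.mp h1) hx0
      · exact hpeq
    have hdvd := addOrderOf_dvd_natCard x
    rw [hord] at hdvd
    exact Nat.le_of_dvd Nat.card_pos hdvd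
  exact exists_sha_ne_zero_of_level_zero_of_prime_le_strict_of_cmRamified W hCM hram h5 hpv Φ hcard P hgen hlev hle

/-! ## §2 `⟸`: LEVEL 0 ∧ class factor non-unit ∧ θ_e-irregular ⟹ `Ш(W)[p] ≠ 0`, for BOTH models (mod Mazur–Wiles) -/

/-- **LEVEL 0 ∧ CLASS FACTOR NON-UNIT ∧ θ_e-IRREGULAR ⟹ `Ш(W/ℚ)[p] ≠ 0` — MODEL-FREE** (CONDITIONAL on Mazur–Wiles Thm. 2, used only on
the ψ-aligned model). `W/ℚ` globally minimal with CM, `p ≥ 5` CM-ramified, `(f, ψ, ω)` a Kriz–Li datum (`ψ` odd, `ω` Teichmüller, trace form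
`hss`), `B_{1,ψ⁻¹} ≠ 0` with `‖B_{1,ψ⁻¹}‖_p ≤ p⁻¹` (CLASS FACTOR NON-UNIT), `P` a generator of `W(ℚ)` modulo torsion of LEVEL `0`, `v ∋ p`, and
ONE number field `K₂` Galois over `ℚ` with `p ∤ [K₂:ℚ]` carrying `χ₂ : Gal(K₂/ℚ) →* ℤ_pˣ` with values `ω(χ_p τ) ψ(χ_f τ)⁻¹` on `Γ_ℚ` and
`#e_{χ₂}(ℤ_p ⊗ Cl K₂) ≠ 1` (θ_e-IRREGULAR). THEN `∃ c ∈ Ш(W/ℚ), c ≠ 0 ∧ p • c = 0`. PROOF: the rational line `Φ = W[𝔭]` with characters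
`θ_S θ_Q = χ̄_p` (`exists_rationalLineData_of_hss`); if `θ_S` is ODD it realises `ψ` and Mazur–Wiles yields a non-zero everywhere-unramified
class of `Φ` (w5 g3), so §1; if `θ_S` is EVEN it is `θ_e`, its Teichmüller lift on `ℚ̄^{ker θ_S}` has the values of `χ₂`, realisation
independence (file B) moves `#e ≠ 1` there, and file D's `exists_sha_ne_zero_of_level_zero_of_lineClassGroupChiCard_ne_one` concludes.
[cite: MazurWiles1984, Thm. 2 (p. 216)] [cite: Washington1997, §10.2] [cite: SilvermanAEC2009, X.§4] -/
theorem exists_sha_ne_zero_of_level_zero_of_classFactor_of_evenIrregular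
    (hMW : MazurWiles1984.thm2_card_oddChiClassGroup_eq_bernoulli)
    (hCM : W.HasCM) (hram : CMRamified W p) (h5 : 5 ≤ p)
    {f : ℕ} [NeZero f] (ψ : DirichletCharacter ℚ_[p] f) (ω : DirichletCharacter ℚ_[p] p)
    (hψ : ψ.Odd) (hω : IsTeichmullerCharacter ω)
    (hss : ∀ ℓ : ℕ, ℓ.Prime → ¬ (ℓ ∣ p * W.conductorNorm ℤ) →
      ‖((W.LFunction ℓ : ℤ) : ℚ_[p]) - (ψ (ℓ : ZMod f) + ψ⁻¹ (ℓ : ZMod f) * ω (ℓ : ZMod p))‖ < 1)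
    (hB0 : bernoulliOnePrim ψ⁻¹ ≠ 0) (hB : ‖bernoulliOnePrim ψ⁻¹‖ ≤ (p : ℝ)⁻¹)
    {v : HeightOneSpectrum (𝓞 ℚ)} (hpv : ((p : ℕ) : 𝓞 ℚ) ∈ v.asIdeal)
    (P : W.toAffine.Point)
    (hgen : ∀ R : W.toAffine.Point, ∃ (k : ℤ) (T : W.toAffine.Point), IsOfFinAddOrder T ∧ R = k • P + T)
    (hlev : ∀ Q : (W.baseChange ℚ_[p]).toAffine.Point, p • Q ≠ W.toPadicPoint p P)
    (K₂ : Type) [Field K₂] [NumberField K₂] [IsGalois ℚ K₂] (hp₂ : ¬ p ∣ Module.finrank ℚ K₂) (χ₂ : (K₂ ≃ₐ[ℚ] K₂) →* ℤ_[p]ˣ)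
    (hχ₂ : ∀ τ : absoluteGaloisGroup ℚ, (((χ₂ (absGaloisQuot ℚ K₂ τ) : ℤ_[p]ˣ) : ℤ_[p]) : ℚ_[p]) =
      ω ((modNCyclotomicCharacter ℚ p τ : (ZMod p)ˣ) : ZMod p) * (ψ ((modNCyclotomicCharacter ℚ f τ : (ZMod f)ˣ) : ZMod f))⁻¹)
    (hne₂ : classGroupChiCard ℚ K₂ p (fun g => ((χ₂ g : ℤ_[p]ˣ) : ℤ_[p])) ≠ 1) :
    ∃ c ∈ W.sha, c ≠ 0 ∧ p • c = 0 := by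
  have hpr : p.Prime := hp.out
  have hp2 : p ≠ 2 := by omega
  haveI hpne : NeZero p := ⟨hpr.ne_zero⟩
  have hB1 : ‖bernoulliOnePrim ψ⁻¹‖ < 1 :=
    hB.trans_lt (inv_lt_one_of_one_lt₀ (by exact_mod_cast hpr.one_lt))
  -- the rational line and its characters
  obtain ⟨Φ, θS, θQ, m, hmz, b, ψ₁, hfM, hmM, hpM, hcard, hθS, hkerS, hθQ, hkerQ, hprod, hSb, hQb, hψ₁, e⟩ :=
    exists_rationalLineData_of_hss p W hCM h5 hram ψ ω hω hss
  have hcontS : ∀ x : Φ.Sub, Continuous fun g : absoluteGaloisGroup ℚ ↦ g • x :=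
    Φ.continuous_smul_sub (LevelDictionary.continuous_smul_geomTorsion W (p : ℤ))
  have hωcyc : ∀ τ : absoluteGaloisGroup ℚ, ω ((modNCyclotomicCharacter ℚ p τ : (ZMod p)ˣ) : ZMod p) =
      (((Kato2004.teichmullerChar p (modNCyclotomicCharacter ℚ p τ) : ℤ_[p]ˣ) : ℤ_[p]) : ℚ_[p]) :=
    fun τ ↦ (BernoulliUnits.coe_teichmullerChar_eq_apply hp2 hω _).symm
  -- a decomposition witness `θ_S g ≠ χ̄_p g` at `p`
  obtain ⟨⟨g₀, -, hg₀⟩, -⟩ := exists_mem_decompositionSubgroup_apply_ne_cyclotomic_at_p W Φ hCM h5 hram hcard θS θQ hθS hθQ hprod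
    hpv (adicCompletionPrime_mem_primesAbove ℚ v)
  rcases e with e | e
  · -- ψ-ALIGNED: `θ_S` is odd and realises `ψ`; Mazur–Wiles gives the unramified class of the line
    have hlam : ∀ τ : absoluteGaloisGroup ℚ, ψ ((modNCyclotomicCharacter ℚ f τ : (ZMod f)ˣ) : ZMod f) =
        (((Kato2004.teichmullerChar p (θS τ) : ℤ_[p]ˣ) : ℤ_[p]) : ℚ_[p]) :=
      LevelDictionaryBeta.apply_modNCyclotomicCharacter_eq_teich_sub b hψ₁ θS hSb hfM hmM ψ e
    have hlamω := LevelDictionaryBeta.not_teichmullerCongruent_of_exists_apply_ne hp2 ψ θS hlam hψ ⟨g₀, hg₀⟩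
    obtain ⟨w, hw, hwI⟩ := LevelDictionaryBeta.exists_unramified_class_of_odd_avatar_of_norm_bernoulli_lt_one hMW hp2 hcard hcontS
      θS hθS hkerS ψ hlam hψ hlamω hB0 hB1
    exact exists_sha_ne_zero_of_level_zero_of_unramified_sub_class W hCM hram h5 hpv Φ hcard P hgen hlev w hw hwI
  · -- ψ-TRANSVERSE: `θ_S` is even (`= θ_e`), `θ_Q` odd realises `ψ`; the field `L = ℚ̄^{ker θ_S}` and the Teichmüller lift of `θ_S`
    have havQ : ∀ τ : absoluteGaloisGroup ℚ, ψ ((modNCyclotomicCharacter ℚ f τ : (ZMod f)ˣ) : ZMod f) =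
        (((Kato2004.teichmullerChar p (θQ τ) : ℤ_[p]ˣ) : ℤ_[p]) : ℚ_[p]) :=
      LevelDictionaryBeta.apply_modNCyclotomicCharacter_eq_teich_quot hp2 b hψ₁ hω θQ hQb hfM hmM hpM ψ e
    have hSQ : ∀ τ : absoluteGaloisGroup ℚ, modNCyclotomicCharacter ℚ p τ * (θQ τ)⁻¹ = θS τ := fun τ ↦ by
      rw [← hprod τ, mul_inv_cancel_right]
    obtain ⟨L, _, _, _, hrange, hpL, hrL⟩ := exists_field_of_character θS (isOpen_ker_character hcard hcontS θS hkerS)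
    haveI : IsGalois ℚ L := IsAbelianGalois.toIsGalois
    set φ : absoluteGaloisGroup ℚ →* ℤ_[p]ˣ := (Kato2004.teichmullerChar p).comp θS with hφdef
    have hφL : ∀ σ : absoluteGaloisGroup L, φ (absGaloisRestrict ℚ L σ) = 1 := fun σ => by
      rw [hφdef, MonoidHom.comp_apply, hrL, map_one]
    obtain ⟨θt, hθt⟩ := HerbrandOddClassGroup.exists_factor_absGaloisQuot ℚ L φ hφL
    have hθt' : ∀ τ : absoluteGaloisGroup ℚ,
        PadicInt.toZMod ((θt (absGaloisQuot ℚ L τ) : ℤ_[p]ˣ) : ℤ_[p]) = ((θS τ : (ZMod p)ˣ) : ZMod p) := fun τ => by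
      rw [hθt, hφdef, MonoidHom.comp_apply, Kato2004.toZMod_teichmullerChar]
    -- `χ₂` and `θ̃` have the same values on `Γ_ℚ`
    have hval : ∀ τ : absoluteGaloisGroup ℚ, χ₂ (absGaloisQuot ℚ K₂ τ) = θt (absGaloisQuot ℚ L τ) := fun τ => by
      apply Units.ext; apply PadicInt.ext
      rw [hχ₂ τ, hθt τ, hφdef, MonoidHom.comp_apply, ← hSQ τ, BernoulliUnits.coe_teichmullerChar_mul,
        BernoulliUnits.coe_teichmullerChar_inv, hωcyc τ, havQ τ]
    exact exists_sha_ne_zero_of_level_zero_of_lineClassGroupChiCard_ne_one_at W hCM hram h5 hpv Φ hcard P hgen hlev θS hθS hkerS L hpL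
      hrL θt hθt' K₂ hp₂ χ₂ hval hne₂

/-! ## §3 `⟹`: LEVEL 0 ∧ `Ш(W)[p] ≠ 0` ⟹ class factor non-unit ∧ θ_e-irregular everywhere (mod Cassels–Tate, GZK) -/

/-- **LEVEL 0 ∧ `Ш(W/ℚ)[p] ≠ 0` ⟹ CLASS FACTOR NON-UNIT ∧ θ_e-IRREGULAR AT EVERY REALISATION** (CONDITIONAL on Cassels–Tate and GZK, `r_an = 1`).
With the Kriz–Li datum and a level-0 generator as in §2: the class factor is a non-unit (`‖B_{1,ψ⁻¹}‖_p ≤ p⁻¹`; contrapositive of w6 g3's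
descent theorem `sha_torsion_eq_zero_of_unit_classFactor`, (α′)) and every Galois realisation `(K₁, χ₁)` of `ω ψ⁻¹` with `p ∤ [K₁:ℚ]` is
class-group IRREGULAR (`classGroupChiCard_ne_one_at_of_sha_ne_zero`, file C). [cite: KrizLi2019, (29) (pp. 49–50)]
[cite: Cassels1962ArithmeticIV] [cite: Washington1997, §10.2 (Thm. 10.9)] -/
theorem classFactor_and_evenIrregular_of_level_zero_of_sha_ne_zero
    (hCT : exists_casselsTate_pairing (K := ℚ)) (hGZK : rank_eq_analyticRank_of_analyticRank_le_one)
    (hCM : W.HasCM) (hram : CMRamified W p) (h5 : 5 ≤ p) (hr : W.analyticRank = 1)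
    {f : ℕ} [NeZero f] (ψ : DirichletCharacter ℚ_[p] f) (ω : DirichletCharacter ℚ_[p] p)
    (hψ : ψ.Odd) (hω : IsTeichmullerCharacter ω)
    (hss : ∀ ℓ : ℕ, ℓ.Prime → ¬ (ℓ ∣ p * W.conductorNorm ℤ) →
      ‖((W.LFunction ℓ : ℤ) : ℚ_[p]) - (ψ (ℓ : ZMod f) + ψ⁻¹ (ℓ : ZMod f) * ω (ℓ : ZMod p))‖ < 1)
    {v : HeightOneSpectrum (𝓞 ℚ)} (hpv : ((p : ℕ) : 𝓞 ℚ) ∈ v.asIdeal)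
    (P : W.toAffine.Point)
    (hlev : ∀ Q : (W.baseChange ℚ_[p]).toAffine.Point, p • Q ≠ W.toPadicPoint p P)
    (hsha : ∃ s ∈ W.sha, s ≠ 0 ∧ p • s = 0) :
    ‖bernoulliOnePrim ψ⁻¹‖ ≤ (p : ℝ)⁻¹ ∧
      ∀ (K₁ : Type) [Field K₁] [NumberField K₁] [IsGalois ℚ K₁], ¬ p ∣ Module.finrank ℚ K₁ →
        ∀ χ₁ : (K₁ ≃ₐ[ℚ] K₁) →* ℤ_[p]ˣ,
          (∀ τ : absoluteGaloisGroup ℚ, (((χ₁ (absGaloisQuot ℚ K₁ τ) : ℤ_[p]ˣ) : ℤ_[p]) : ℚ_[p]) =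
            ω ((modNCyclotomicCharacter ℚ p τ : (ZMod p)ˣ) : ZMod p) * (ψ ((modNCyclotomicCharacter ℚ f τ : (ZMod f)ˣ) : ZMod f))⁻¹) →
          classGroupChiCard ℚ K₁ p (fun g => ((χ₁ g : ℤ_[p]ˣ) : ℤ_[p])) ≠ 1 := by
  obtain ⟨s, hs, hs0, hps⟩ := hsha
  refine ⟨?_, fun K₁ _ _ _ hp₁ χ₁ hχ₁ =>
    classGroupChiCard_ne_one_at_of_sha_ne_zero W hCT hGZK hCM hram h5 hr ψ ω hψ hω hss hpv ⟨s, hs, hs0, hps⟩ K₁ hp₁ χ₁ hχ₁⟩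
  -- class factor non-unit: otherwise (α′) kills `s`
  by_contra hunit
  have hP : ∀ R : W.toAffine.Point, (p : ℤ) • R ≠ P := fun R hR => hlev (W.toPadicPoint p R) (by
    rw [← map_nsmul, ← natCast_zsmul, hR])
  exact hs0 (sha_torsion_eq_zero_of_unit_classFactor W p hCM hram h5 ψ ω hψ hω hss hunit P hP hs hps)

/-! ## §4 The IFF -/

/-- **THE LEVEL-0 CENSUS (model-free): `Ш(W)[p] ≠ 0 ⟺ (class factor non-unit ∧ θ_e-irregular)`.** `W/ℚ` globally minimal with CM,
`p ≥ 5` CM-ramified, `r_an(W) = 1`, `(f, ψ, ω)` a Kriz–Li datum with `hss` and `B_{1,ψ⁻¹} ≠ 0`, `P` a generator of `W(ℚ)` modulo torsion of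
LEVEL `0`, `v ∋ p`; granted Mazur–Wiles Thm. 2, Cassels–Tate and GZK: `Ш(W/ℚ)` has a non-zero element killed by `p` IFF `‖B_{1,ψ⁻¹}‖_p ≤ p⁻¹`
AND every Galois realisation `(K, χ)` of `ω ψ⁻¹` with `p ∤ [K:ℚ]` has `#e_χ(ℤ_p ⊗ Cl K) ≠ 1` (equivalently, by realisation independence, ONE
such realisation has). So B1-sha⁰'s level-0 members are exactly the off-locus θ_e-irregular ones, for either `p`-isogenous model.
[cite: MazurWiles1984, Thm. 2 (p. 216)] [cite: Cassels1962ArithmeticIV] [cite: Washington1997, §10.2] [cite: KrizLi2019, (29)] -/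
theorem sha_ne_zero_iff_of_level_zero
    (hMW : MazurWiles1984.thm2_card_oddChiClassGroup_eq_bernoulli)
    (hCT : exists_casselsTate_pairing (K := ℚ)) (hGZK : rank_eq_analyticRank_of_analyticRank_le_one)
    (hCM : W.HasCM) (hram : CMRamified W p) (h5 : 5 ≤ p) (hr : W.analyticRank = 1)
    {f : ℕ} [NeZero f] (ψ : DirichletCharacter ℚ_[p] f) (ω : DirichletCharacter ℚ_[p] p)
    (hψ : ψ.Odd) (hω : IsTeichmullerCharacter ω)
    (hss : ∀ ℓ : ℕ, ℓ.Prime → ¬ (ℓ ∣ p * W.conductorNorm ℤ) →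
      ‖((W.LFunction ℓ : ℤ) : ℚ_[p]) - (ψ (ℓ : ZMod f) + ψ⁻¹ (ℓ : ZMod f) * ω (ℓ : ZMod p))‖ < 1)
    (hB0 : bernoulliOnePrim ψ⁻¹ ≠ 0)
    {v : HeightOneSpectrum (𝓞 ℚ)} (hpv : ((p : ℕ) : 𝓞 ℚ) ∈ v.asIdeal)
    (P : W.toAffine.Point)
    (hgen : ∀ R : W.toAffine.Point, ∃ (k : ℤ) (T : W.toAffine.Point), IsOfFinAddOrder T ∧ R = k • P + T)
    (hlev : ∀ Q : (W.baseChange ℚ_[p]).toAffine.Point, p • Q ≠ W.toPadicPoint p P) :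
    (∃ s ∈ W.sha, s ≠ 0 ∧ p • s = 0) ↔
      (‖bernoulliOnePrim ψ⁻¹‖ ≤ (p : ℝ)⁻¹ ∧
        ∀ (K₁ : Type) [Field K₁] [NumberField K₁] [IsGalois ℚ K₁], ¬ p ∣ Module.finrank ℚ K₁ →
          ∀ χ₁ : (K₁ ≃ₐ[ℚ] K₁) →* ℤ_[p]ˣ,
            (∀ τ : absoluteGaloisGroup ℚ, (((χ₁ (absGaloisQuot ℚ K₁ τ) : ℤ_[p]ˣ) : ℤ_[p]) : ℚ_[p]) =
              ω ((modNCyclotomicCharacter ℚ p τ : (ZMod p)ˣ) : ZMod p) *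
                (ψ ((modNCyclotomicCharacter ℚ f τ : (ZMod f)ˣ) : ZMod f))⁻¹) →
            classGroupChiCard ℚ K₁ p (fun g => ((χ₁ g : ℤ_[p]ˣ) : ℤ_[p])) ≠ 1) := by
  refine ⟨classFactor_and_evenIrregular_of_level_zero_of_sha_ne_zero W hCT hGZK hCM hram h5 hr ψ ω hψ hω hss hpv P hlev, fun h => ?_⟩
  obtain ⟨hB, hirr⟩ := h
  have hpr : p.Prime := hp.out
  have hp2 : p ≠ 2 := by omega
  haveI hpne : NeZero p := ⟨hpr.ne_zero⟩
  -- a realisation to instantiate `hirr`: the field cut out by `θ_e` (whichever of `θ_S`, `θ_Q` is even) with its Teichmüller lift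
  obtain ⟨Φ, θS, θQ, m, hmz, b, ψ₁, hfM, hmM, hpM, hcard, hθS, hkerS, hθQ, hkerQ, hprod, hSb, hQb, hψ₁, e⟩ :=
    exists_rationalLineData_of_hss p W hCM h5 hram ψ ω hω hss
  have hcardQ : Nat.card Φ.Quot = p := HerbrandLineRestriction.natCard_quot_eq_of_card_sub W Φ hcard
  have hcontS : ∀ x : Φ.Sub, Continuous fun g : absoluteGaloisGroup ℚ ↦ g • x :=
    Φ.continuous_smul_sub (LevelDictionary.continuous_smul_geomTorsion W (p : ℤ))
  have hcontQ : ∀ y : Φ.Quot, Continuous fun g : absoluteGaloisGroup ℚ ↦ g • y :=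
    Φ.continuous_smul_quot (LevelDictionary.continuous_smul_geomTorsion W (p : ℤ))
  have hωcyc : ∀ τ : absoluteGaloisGroup ℚ, ω ((modNCyclotomicCharacter ℚ p τ : (ZMod p)ˣ) : ZMod p) =
      (((Kato2004.teichmullerChar p (modNCyclotomicCharacter ℚ p τ) : ℤ_[p]ˣ) : ℤ_[p]) : ℚ_[p]) :=
    fun τ ↦ (BernoulliUnits.coe_teichmullerChar_eq_apply hp2 hω _).symm
  -- the even character `θ_e` as a character of `Γ_ℚ`, with `Teich(θ_e τ) = ω(χ_p τ) ψ(χ_f τ)⁻¹`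
  obtain ⟨θe, hopen, hval⟩ : ∃ θe : absoluteGaloisGroup ℚ →* (ZMod p)ˣ, IsOpen (θe.ker : Set (absoluteGaloisGroup ℚ)) ∧
      ∀ τ : absoluteGaloisGroup ℚ, (((Kato2004.teichmullerChar p (θe τ) : ℤ_[p]ˣ) : ℤ_[p]) : ℚ_[p]) =
        ω ((modNCyclotomicCharacter ℚ p τ : (ZMod p)ˣ) : ZMod p) *
          (ψ ((modNCyclotomicCharacter ℚ f τ : (ZMod f)ˣ) : ZMod f))⁻¹ := by
    rcases e with e | e
    · -- `θ_S` odd realises `ψ`; `θ_e = θ_Q = χ̄_p θ_S⁻¹`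
      have havS : ∀ τ : absoluteGaloisGroup ℚ, ψ ((modNCyclotomicCharacter ℚ f τ : (ZMod f)ˣ) : ZMod f) =
          (((Kato2004.teichmullerChar p (θS τ) : ℤ_[p]ˣ) : ℤ_[p]) : ℚ_[p]) :=
        LevelDictionaryBeta.apply_modNCyclotomicCharacter_eq_teich_sub b hψ₁ θS hSb hfM hmM ψ e
      have hQS : ∀ τ : absoluteGaloisGroup ℚ, modNCyclotomicCharacter ℚ p τ * (θS τ)⁻¹ = θQ τ := fun τ ↦ by
        rw [← hprod τ, mul_comm (θS τ), mul_inv_cancel_right]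
      refine ⟨θQ, isOpen_ker_character hcardQ hcontQ θQ hkerQ, fun τ => ?_⟩
      rw [← hQS τ, BernoulliUnits.coe_teichmullerChar_mul, BernoulliUnits.coe_teichmullerChar_inv, hωcyc τ, havS τ]
    · -- `θ_Q` odd realises `ψ`; `θ_e = θ_S = χ̄_p θ_Q⁻¹`
      have havQ : ∀ τ : absoluteGaloisGroup ℚ, ψ ((modNCyclotomicCharacter ℚ f τ : (ZMod f)ˣ) : ZMod f) =
          (((Kato2004.teichmullerChar p (θQ τ) : ℤ_[p]ˣ) : ℤ_[p]) : ℚ_[p]) :=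
        LevelDictionaryBeta.apply_modNCyclotomicCharacter_eq_teich_quot hp2 b hψ₁ hω θQ hQb hfM hmM hpM ψ e
      have hSQ : ∀ τ : absoluteGaloisGroup ℚ, modNCyclotomicCharacter ℚ p τ * (θQ τ)⁻¹ = θS τ := fun τ ↦ by
        rw [← hprod τ, mul_inv_cancel_right]
      refine ⟨θS, isOpen_ker_character hcard hcontS θS hkerS, fun τ => ?_⟩
      rw [← hSQ τ, BernoulliUnits.coe_teichmullerChar_mul, BernoulliUnits.coe_teichmullerChar_inv, hωcyc τ, havQ τ]
  obtain ⟨L, _, _, _, hrange, hpL, hrL⟩ := exists_field_of_character θe hopen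
  haveI : IsGalois ℚ L := IsAbelianGalois.toIsGalois
  set φ : absoluteGaloisGroup ℚ →* ℤ_[p]ˣ := (Kato2004.teichmullerChar p).comp θe with hφdef
  have hφL : ∀ σ : absoluteGaloisGroup L, φ (absGaloisRestrict ℚ L σ) = 1 := fun σ => by
    rw [hφdef, MonoidHom.comp_apply, hrL, map_one]
  obtain ⟨θt, hθt⟩ := HerbrandOddClassGroup.exists_factor_absGaloisQuot ℚ L φ hφL
  have hχL : ∀ τ : absoluteGaloisGroup ℚ, (((θt (absGaloisQuot ℚ L τ) : ℤ_[p]ˣ) : ℤ_[p]) : ℚ_[p]) =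
      ω ((modNCyclotomicCharacter ℚ p τ : (ZMod p)ˣ) : ZMod p) * (ψ ((modNCyclotomicCharacter ℚ f τ : (ZMod f)ˣ) : ZMod f))⁻¹ :=
    fun τ => by rw [hθt, hφdef, MonoidHom.comp_apply, hval]
  have hne := hirr L hpL θt hχL
  exact exists_sha_ne_zero_of_level_zero_of_classFactor_of_evenIrregular W hMW hCM hram h5 ψ ω hψ hω hss hB0 hB hpv P hgen hlev L hpL θt
    hχL hne

end Summit.BirchSwinnertonDyer.BirchSwinnertonDyer.Theorems.PrintCFram.SelmerCount

end
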